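import Literature.AlgebraicGeometry.Deformation.SmoothSchemeLiftObstructionFunctorialRep
import Literature.AlgebraicGeometry.Deformation.SmoothSchemeLiftObstructionCechCocycle
import Literature.AlgebraicGeometry.HodgeTheory.CotangentSheafAffineSemilinearLift
import Literature.AlgebraicGeometry.HodgeTheory.CotangentSheafComap
import HarnessLib

/-!
# Čech bookkeeping of the functoriality of the obstruction class, II: the identity on `1`-forms, the pull-back term, and
# «defect readings commute with restriction»
# (Hartshorne, *Deformation Theory*, proof of Thm. 10.2; Hartshorne, *Algebraic Geometry* II.8)

Layer `Literature/AlgebraicGeometry/Deformation`, namespace `Literature.AlgebraicGeometry.Deformation` (THEOREMS only: no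
definition, no instance, no notation, no named fact).  Second of three files (independent of `…FunctorialCechRestrict`; both feed
the head `…FunctorialCech.exists_cechMD1_eq_comap_obstruction_sub`).  All statements are on ONE affine open `W ⊆ X` with
`W′ ⊆ f⁻¹W`, and concern additive `f♯`-SEMILINEAR maps `Γ(W, Ω¹_X) → Γ(W′, 𝒪_Y)` (★ `exists_semilinear_lift_of_leibniz`,
`semilinear_ext_dSection`: determined by their values on exact forms):

* §1 the identity on `1`-FORMS over one affine triple overlap (`semilinear_obstruction_functorial_rep`): the representing-section
  identity ★ `appLE_obstruction_functorial_rep`, extended from exact forms: `f♯(θ^X(ω)) = ℓ^Y(ω) + ℓ_jl(ω) + ℓ_lm(ω) − ℓ_jm(ω)`;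
* §2 the pull-back term: the `f♯`-semilinear lift of `c ↦ θ^Y(d(f♯c))` is `η ↦ θ^Y((f^*η)|)` (`semilinear_lift_eq_comap`, ★
  `cotangentSheaf.comap`, `comap_app_dSection`);
* §3 the `1`-form reading of a defect coordinate COMMUTES WITH RESTRICTION to a smaller principal open (`defectReading_restrict`).

Cell `hodgecm-mathlib` (D-0151), F-11 α1 / J4-(iv) road (a′) brick (iv-1b) FILE B2 (B-p08 (g16); F0P1b-plan (R34); F0P1b-p05 FIT LIST slot (3)
rel₁).  HC_CM is proved only modulo the 7 printed citations until rung 0 closes — nothing here bears on a summit statement.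

## References
* [Hartshorne2010] R. Hartshorne, *Deformation Theory*, GTM 257, Springer (2010): Thm. 10.2 (a) and its proof (p. 81),
  Remark 10.1.1 (p. 80), Cor. 10.3 (p. 82).
* [Hartshorne1977] R. Hartshorne, *Algebraic Geometry* (1977): II.8 p. 172, II Remark 8.9.2 (p. 175), III §4 p. 218.
* (prose only) L. Illusie, in *FGA Explained*, AMS (2005), §8.5; F. Oort, Compositio Math. 23 (1971), §2.2.
-/

noncomputable section

-- `TopCat.Presheaf`/`Scheme.Modules` are not reducible (as in ★ F2 `SmoothSchemeLiftObstructionCechCocycle`).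
set_option backward.isDefEq.respectTransparency false

open CategoryTheory AlgebraicGeometry Opposite TopologicalSpace
open scoped TensorProduct

universe u

namespace Literature.AlgebraicGeometry.Deformation

open Literature.AlgebraicGeometry.HodgeTheory Literature.AlgebraicGeometry.Modules
  Literature.AlgebraicGeometry.Motives Literature.AlgebraicGeometry.Morphisms SmoothAffineDeformation

variable {k : Type u} [Field k] {X Y : Over (Spec (CommRingCat.of k))}
  [instΓX : ∀ W : X.left.Opens, Algebra k Γ(X.left, W)] [instΓY : ∀ W : Y.left.Opens, Algebra k Γ(Y.left, W)]
  (halgX : ∀ (W : X.left.Opens) (s : k), algebraMap k Γ(X.left, W) s = (constToPresheaf X).app (op W) s)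
  (halgY : ∀ (W : Y.left.Opens) (s : k), algebraMap k Γ(Y.left, W) s = (constToPresheaf Y).app (op W) s)
  (f : Y ⟶ X)

variable {A' : Type u} [CommRing A'] [Algebra k A']

/-! ## §1 The identity on `1`-forms over one affine triple overlap -/

section Forms

variable (J : Ideal A') (hJ : J * J = ⊥) {𝔫' : Ideal A'} (hJ𝔫 : J * 𝔫' = ⊥) (e : ↥(J.restrictScalars k) ≃ₗ[k] k)
  {W : X.left.Opens} {W' : Y.left.Opens} (g : Γ(X.left, W) →ₐ[k] Γ(Y.left, W'))

include halgX in
/-- A `g`-derivation killing the constants is `k`-homogeneous. [cite: Hartshorne1977, II.8 p. 172] -/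
theorem smul_of_leibniz_of_const {δ : Γ(X.left, W) → Γ(Y.left, W')}
    (hmul : ∀ a b, δ (a * b) = g a * δ b + g b * δ a) (hconst : ∀ s : k, δ ((constToPresheaf X).app (op W) s) = 0)
    (s : k) (a : Γ(X.left, W)) : δ (s • a) = s • δ a := by
  rw [Algebra.smul_def, hmul, halgX, hconst, mul_zero, add_zero, ← halgX, AlgHom.commutes, ← Algebra.smul_def]

/-- `ω ↦ g(θ(ω))` is `g`-semilinear. [cite: Hartshorne1977, II.8 p. 180] -/
theorem appLE_smul_mul (θX : (cotangentSheaf X).over W ⟶ (unitModule X.left).over W) (r : Γ(X.left, W))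
    (ω : Γ(cotangentSheaf X, W)) :
    g (show Γ(X.left, W) from appLE θX (𝟙 W) (r • ω)) = g r * g (show Γ(X.left, W) from appLE θX (𝟙 W) ω) := by
  rw [appLE_smul_right, ← map_mul]
  rfl

include hJ hJ𝔫 halgX in
/-- **FUNCTORIALITY OF THE OBSTRUCTION ON `1`-FORMS, one affine triple overlap.**  In the setting of ★
`appLE_obstruction_functorial_rep` (defect coordinates `δ_jl, δ_lm, δ_jm` of the three pairs of lifts, each a `g`-derivation
killing the constants, ★ `exists_defectCoord`) on an AFFINE `W`, let `ℓ^Y, ℓ_jl, ℓ_lm, ℓ_jm : Γ(W, Ω¹_X) → Γ(W′, 𝒪_Y)` be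
`g`-semilinear additive maps reading `c ↦ θ^Y(d(g c))`, `δ_jl`, `δ_lm`, `δ_jm` on exact forms (they exist and are unique, ★
`exists_semilinear_lift_of_leibniz`).  Then for EVERY `ω ∈ Γ(W, Ω¹_X)`:
**`g(θ^X(ω)) = ℓ^Y(ω) + ℓ_jl(ω) + ℓ_lm(ω) − ℓ_jm(ω)`** (both sides are `g`-semilinear and agree on the `dc`, which span,
★ `semilinear_ext_dSection`). [cite: Hartshorne2010, Thm. 10.2 (proof), p. 81] [cite: Hartshorne1977, II Remark 8.9.2 (p. 175)] -/
theorem semilinear_obstruction_functorial_rep (hWaff : IsAffineOpen W)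
    (ρXjl ρXlm ρXjm : A' ⊗[k] Γ(X.left, W) ≃ₐ[A'] A' ⊗[k] Γ(X.left, W))
    (ρYjl ρYlm ρYjm : A' ⊗[k] Γ(Y.left, W') ≃ₐ[A'] A' ⊗[k] Γ(Y.left, W'))
    (hρXjl : ∀ x, ρXjl x - x ∈ 𝔫' • (⊤ : Submodule A' (A' ⊗[k] Γ(X.left, W))))
    (hρXjm : ∀ x, ρXjm x - x ∈ 𝔫' • (⊤ : Submodule A' (A' ⊗[k] Γ(X.left, W))))
    (hρYjl : ∀ x, ρYjl x - x ∈ 𝔫' • (⊤ : Submodule A' (A' ⊗[k] Γ(Y.left, W'))))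
    (hρYlm : ∀ x, ρYlm x - x ∈ 𝔫' • (⊤ : Submodule A' (A' ⊗[k] Γ(Y.left, W'))))
    (hρYjm : ∀ x, ρYjm x - x ∈ 𝔫' • (⊤ : Submodule A' (A' ⊗[k] Γ(Y.left, W'))))
    (θX : (cotangentSheaf X).over W ⟶ (unitModule X.left).over W)
    (hθX : ∀ c : Γ(X.left, W), (ρXlm * ρXjl * ρXjm⁻¹) ((1 : A') ⊗ₜ c) =
      (1 : A') ⊗ₜ c + ((e.symm 1 : ↥(J.restrictScalars k)) : A') ⊗ₜ
        (show Γ(X.left, W) from appLE θX (𝟙 W) (dSection X W c)))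
    (θY : (cotangentSheaf Y).over W' ⟶ (unitModule Y.left).over W')
    (hθY : ∀ c : Γ(Y.left, W'), (ρYlm * ρYjl * ρYjm⁻¹) ((1 : A') ⊗ₜ c) =
      (1 : A') ⊗ₜ c + ((e.symm 1 : ↥(J.restrictScalars k)) : A') ⊗ₜ
        (show Γ(Y.left, W') from appLE θY (𝟙 W') (dSection Y W' c)))
    (Fj Fl Fm : A' ⊗[k] Γ(X.left, W) →ₐ[A'] A' ⊗[k] Γ(Y.left, W'))
    (hFm : ∀ c : Γ(X.left, W), Fm ((1 : A') ⊗ₜ c) - (1 : A') ⊗ₜ g c ∈ 𝔫' • (⊤ : Submodule A' (A' ⊗[k] Γ(Y.left, W'))))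
    (δjl δlm δjm : Γ(X.left, W) → Γ(Y.left, W'))
    (hjl : ∀ c, Fl (ρXjl ((1 : A') ⊗ₜ c)) =
      ρYjl (Fj ((1 : A') ⊗ₜ c)) + ((e.symm 1 : ↥(J.restrictScalars k)) : A') ⊗ₜ δjl c)
    (hlm : ∀ c, Fm (ρXlm ((1 : A') ⊗ₜ c)) =
      ρYlm (Fl ((1 : A') ⊗ₜ c)) + ((e.symm 1 : ↥(J.restrictScalars k)) : A') ⊗ₜ δlm c)
    (hjm : ∀ c, Fm (ρXjm ((1 : A') ⊗ₜ c)) =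
      ρYjm (Fj ((1 : A') ⊗ₜ c)) + ((e.symm 1 : ↥(J.restrictScalars k)) : A') ⊗ₜ δjm c)
    (hδjl : ∀ a b, δjl (a + b) = δjl a + δjl b) (hδjlm : ∀ a b, δjl (a * b) = g a * δjl b + g b * δjl a)
    (hδjlc : ∀ s : k, δjl ((constToPresheaf X).app (op W) s) = 0)
    (hδlm : ∀ a b, δlm (a + b) = δlm a + δlm b) (hδlmm : ∀ a b, δlm (a * b) = g a * δlm b + g b * δlm a)
    (hδlmc : ∀ s : k, δlm ((constToPresheaf X).app (op W) s) = 0)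
    (hδjm : ∀ a b, δjm (a + b) = δjm a + δjm b) (hδjmm : ∀ a b, δjm (a * b) = g a * δjm b + g b * δjm a)
    (hδjmc : ∀ s : k, δjm ((constToPresheaf X).app (op W) s) = 0)
    (ℓY ℓjl ℓlm ℓjm : Γ(cotangentSheaf X, W) →+ Γ(Y.left, W'))
    (hℓY : ∀ (r : Γ(X.left, W)) (ω : Γ(cotangentSheaf X, W)), ℓY (r • ω) = g r * ℓY ω)
    (hℓYd : ∀ c : Γ(X.left, W), ℓY (dSection X W c) =
      (show Γ(Y.left, W') from appLE θY (𝟙 W') (dSection Y W' (g c))))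
    (hℓjl : ∀ (r : Γ(X.left, W)) (ω : Γ(cotangentSheaf X, W)), ℓjl (r • ω) = g r * ℓjl ω)
    (hℓjld : ∀ c : Γ(X.left, W), ℓjl (dSection X W c) = δjl c)
    (hℓlm : ∀ (r : Γ(X.left, W)) (ω : Γ(cotangentSheaf X, W)), ℓlm (r • ω) = g r * ℓlm ω)
    (hℓlmd : ∀ c : Γ(X.left, W), ℓlm (dSection X W c) = δlm c)
    (hℓjm : ∀ (r : Γ(X.left, W)) (ω : Γ(cotangentSheaf X, W)), ℓjm (r • ω) = g r * ℓjm ω)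
    (hℓjmd : ∀ c : Γ(X.left, W), ℓjm (dSection X W c) = δjm c)
    (ω : Γ(cotangentSheaf X, W)) :
    g (show Γ(X.left, W) from appLE θX (𝟙 W) ω) = ℓY ω + ℓjl ω + ℓlm ω - ℓjm ω := by
  -- the left-hand side as an additive `g`-semilinear map
  let L : Γ(cotangentSheaf X, W) →+ Γ(Y.left, W') :=
    { toFun := fun ω => g (show Γ(X.left, W) from appLE θX (𝟙 W) ω)
      map_zero' := by
        change g (show Γ(X.left, W) from appLE θX (𝟙 W) 0) = 0
        rw [appLE_zero_right]; exact map_zero g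
      map_add' := fun ω ω' => by
        change g (show Γ(X.left, W) from appLE θX (𝟙 W) (ω + ω')) = _
        rw [appLE_add_right]; exact map_add g _ _ }
  have hL : ∀ (r : Γ(X.left, W)) (ω : Γ(cotangentSheaf X, W)), L (r • ω) = g r * L ω := fun r ω =>
    appLE_smul_mul g θX r ω
  -- the right-hand side
  let R : Γ(cotangentSheaf X, W) →+ Γ(Y.left, W') := ℓY + ℓjl + ℓlm - ℓjm
  have hR : ∀ (r : Γ(X.left, W)) (ω : Γ(cotangentSheaf X, W)), R (r • ω) = g r * R ω := fun r ω => by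
    change ℓY (r • ω) + ℓjl (r • ω) + ℓlm (r • ω) - ℓjm (r • ω) = g r * (ℓY ω + ℓjl ω + ℓlm ω - ℓjm ω)
    rw [hℓY, hℓjl, hℓlm, hℓjm]; ring
  have key : L = R := by
    refine semilinear_ext_dSection g hWaff hL hR fun c => ?_
    change g (show Γ(X.left, W) from appLE θX (𝟙 W) (dSection X W c)) =
      ℓY (dSection X W c) + ℓjl (dSection X W c) + ℓlm (dSection X W c) - ℓjm (dSection X W c)
    rw [hℓYd, hℓjld, hℓlmd, hℓjmd]
    exact appLE_obstruction_functorial_rep J hJ hJ𝔫 e g ρXjl ρXlm ρXjm ρYjl ρYlm ρYjm hρXjl hρXjm hρYjl hρYlm hρYjm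
      θX hθX θY hθY Fj Fl Fm hFm δjl δlm δjm hjl hlm hjm hδjl (smul_of_leibniz_of_const halgX g hδjlm hδjlc)
      hδlm (smul_of_leibniz_of_const halgX g hδlmm hδlmc) hδjm (smul_of_leibniz_of_const halgX g hδjmm hδjmc) c
  have := DFunLike.congr_fun key ω
  exact this

end Forms

/-! ## §2 The pull-back term -/

section PairData

variable (J 𝔫' : Ideal A') (hJ : J * J = ⊥) (hJ𝔫 : J * 𝔫' = ⊥) (h𝔫 : IsNilpotent 𝔫')
  (e : ↥(J.restrictScalars k) ≃ₗ[k] k)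

omit instΓX instΓY in
/-- **The pull-back term**: on an affine `W ⊆ X` with `W′ ⊆ f⁻¹W`, the `f♯`-semilinear lift `ℓ^Y` of `c ↦ θ^Y(d(f♯ c))` is
`η ↦ θ^Y((f^*η)|_{W′})` (★ `cotangentSheaf.comap`, `comap_app_dSection`; both are semilinear lifts of the same derivation).
[cite: Hartshorne1977, II.8 p. 172 and II Remark 8.9.2 (p. 175)] -/
theorem semilinear_lift_eq_comap {W : X.left.Opens} {W' : Y.left.Opens} (hW : IsAffineOpen W) (hWW' : W' ≤ f.left ⁻¹ᵁ W)
    (θY : (cotangentSheaf Y).over W' ⟶ (unitModule Y.left).over W')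
    (ℓY : Γ(cotangentSheaf X, W) →+ Γ(Y.left, W'))
    (hℓY : ∀ (r : Γ(X.left, W)) (η : Γ(cotangentSheaf X, W)), ℓY (r • η) = f.left.appLE W W' hWW' r * ℓY η)
    (hℓYd : ∀ c : Γ(X.left, W), ℓY (dSection X W c) =
      (show Γ(Y.left, W') from appLE θY (𝟙 W') (dSection Y W' (f.left.appLE W W' hWW' c))))
    (η : Γ(cotangentSheaf X, W)) :
    ℓY η = (show Γ(Y.left, W') from appLE θY (𝟙 W')
      ((cotangentSheaf Y).presheaf.map (homOfLE hWW').op ((cotangentSheaf.comap f).app W η))) := by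
  let Λ : Γ(cotangentSheaf X, W) →+ Γ(Y.left, W') :=
    { toFun := fun η => (show Γ(Y.left, W') from appLE θY (𝟙 W')
        ((cotangentSheaf Y).presheaf.map (homOfLE hWW').op ((cotangentSheaf.comap f).app W η)))
      map_zero' := by
        change appLE θY (𝟙 W') ((cotangentSheaf Y).presheaf.map (homOfLE hWW').op ((cotangentSheaf.comap f).app W 0)) = 0
        rw [map_zero, map_zero, appLE_zero_right]
      map_add' := fun η η' => by
        change appLE θY (𝟙 W') ((cotangentSheaf Y).presheaf.map (homOfLE hWW').op
          ((cotangentSheaf.comap f).app W (η + η'))) = _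
        rw [map_add, map_add, appLE_add_right] }
  have hΛ : ∀ (r : Γ(X.left, W)) (η : Γ(cotangentSheaf X, W)), Λ (r • η) = f.left.appLE W W' hWW' r * Λ η := by
    intro r η
    change appLE θY (𝟙 W') ((cotangentSheaf Y).presheaf.map (homOfLE hWW').op
        ((cotangentSheaf.comap f).app W (r • η))) = _
    rw [Scheme.Modules.Hom.app_smul]
    have hsm : (r • (cotangentSheaf.comap f).app W η : Γ(pushforwardCotangentSheaf f, W)) =
        ((f.left.app W r • (show Γ(cotangentSheaf Y, f.left ⁻¹ᵁ W) from (cotangentSheaf.comap f).app W η)) :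
          Γ(cotangentSheaf Y, f.left ⁻¹ᵁ W)) := rfl
    rw [hsm]
    change appLE θY (𝟙 W') ((cotangentSheaf Y).presheaf.map (homOfLE hWW').op
        (f.left.app W r • (show Γ(cotangentSheaf Y, f.left ⁻¹ᵁ W) from (cotangentSheaf.comap f).app W η))) = _
    rw [Scheme.Modules.map_smul, appLE_smul_right]
    rfl
  have hΛd : ∀ c : Γ(X.left, W), Λ (dSection X W c) =
      (show Γ(Y.left, W') from appLE θY (𝟙 W') (dSection Y W' (f.left.appLE W W' hWW' c))) := fun c => by
    change appLE θY (𝟙 W') ((cotangentSheaf Y).presheaf.map (homOfLE hWW').op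
        ((cotangentSheaf.comap f).app W (dSection X W c))) = _
    rw [comap_app_dSection, map_dSection]
    rfl
  have key : ℓY = Λ := semilinear_ext_dSection (f.left.appLE W W' hWW').hom hW hℓY hΛ fun c => by rw [hℓYd, hΛd]
  exact DFunLike.congr_fun key η

end PairData

/-! ## §3 Defect coordinates commute with restriction -/

section Restrict

variable (J : Ideal A') (e : ↥(J.restrictScalars k) ≃ₗ[k] k)

/-- **The `1`-form reading of a defect coordinate commutes with restriction.**  A pair `(P, Q)` of chart lifts on `V → V′`
with defect coordinate `δ₀` (w.r.t. `ψ, ψ′`) and `f♯`-semilinear reading `ℓ₀`, and its restriction `(T_P, T_Q)` to principal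
`W ⊆ V`, `W′ ⊆ V′` (characterised through base-change maps `Φ`) with defect coordinate `δ₀^W` (w.r.t. the restricted `ρ, ρ′`)
and reading `ℓ₀^W`: then `ℓ₀^W(η|_W) = ℓ₀(η)|_{W′}` for every `η ∈ Γ(V, Ω¹_X)`, `V` affine (both sides are `f♯`-semilinear and
agree on exact forms, where `t ⊗ δ₀^W(c|) = Φ(t ⊗ δ₀(c))`; ★ `semilinear_ext_dSection`).
[cite: Hartshorne2010, Thm. 10.2 (proof), p. 81] [cite: Hartshorne1977, II.8 p. 172] -/
theorem defectReading_restrict {V W : X.left.Opens} {V' W' : Y.left.Opens} (hVaff : IsAffineOpen V) (hV : W ≤ V)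
    (hV' : W' ≤ V') (hVV' : V' ≤ f.left ⁻¹ᵁ V) (hWW' : W' ≤ f.left ⁻¹ᵁ W)
    {ΦX : A' ⊗[k] Γ(X.left, V) →ₐ[A'] A' ⊗[k] Γ(X.left, W)}
    (hΦX : ∀ a s, ΦX (a ⊗ₜ s) = a ⊗ₜ X.left.presheaf.map (homOfLE hV).op s)
    {ΦY : A' ⊗[k] Γ(Y.left, V') →ₐ[A'] A' ⊗[k] Γ(Y.left, W')}
    (hΦY : ∀ a s, ΦY (a ⊗ₜ s) = a ⊗ₜ Y.left.presheaf.map (homOfLE hV').op s)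
    (P Q : A' ⊗[k] Γ(X.left, V) →ₐ[A'] A' ⊗[k] Γ(Y.left, V'))
    (ψ : A' ⊗[k] Γ(X.left, V) ≃ₐ[A'] A' ⊗[k] Γ(X.left, V)) (ψ' : A' ⊗[k] Γ(Y.left, V') ≃ₐ[A'] A' ⊗[k] Γ(Y.left, V'))
    (δ₀ : Γ(X.left, V) → Γ(Y.left, V'))
    (hδ₀ : ∀ c, Q (ψ ((1 : A') ⊗ₜ c)) = ψ' (P ((1 : A') ⊗ₜ c)) + ((e.symm 1 : ↥(J.restrictScalars k)) : A') ⊗ₜ δ₀ c)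
    (ℓ₀ : Γ(cotangentSheaf X, V) →+ Γ(Y.left, V'))
    (hℓ₀ : ∀ (r : Γ(X.left, V)) (η : Γ(cotangentSheaf X, V)), ℓ₀ (r • η) = f.left.appLE V V' hVV' r * ℓ₀ η)
    (hℓ₀d : ∀ c, ℓ₀ (dSection X V c) = δ₀ c)
    (TP TQ : A' ⊗[k] Γ(X.left, W) →ₐ[A'] A' ⊗[k] Γ(Y.left, W'))
    (hTP : ∀ x, TP (ΦX x) = ΦY (P x)) (hTQ : ∀ x, TQ (ΦX x) = ΦY (Q x))
    (ρ : A' ⊗[k] Γ(X.left, W) ≃ₐ[A'] A' ⊗[k] Γ(X.left, W)) (hρ : ∀ x, ρ (ΦX x) = ΦX (ψ x))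
    (ρ' : A' ⊗[k] Γ(Y.left, W') ≃ₐ[A'] A' ⊗[k] Γ(Y.left, W')) (hρ' : ∀ x, ρ' (ΦY x) = ΦY (ψ' x))
    (δ₀W : Γ(X.left, W) → Γ(Y.left, W'))
    (hδ₀W : ∀ c, TQ (ρ ((1 : A') ⊗ₜ c)) = ρ' (TP ((1 : A') ⊗ₜ c)) + ((e.symm 1 : ↥(J.restrictScalars k)) : A') ⊗ₜ δ₀W c)
    (ℓ₀W : Γ(cotangentSheaf X, W) →+ Γ(Y.left, W'))
    (hℓ₀W : ∀ (r : Γ(X.left, W)) (η : Γ(cotangentSheaf X, W)), ℓ₀W (r • η) = f.left.appLE W W' hWW' r * ℓ₀W η)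
    (hℓ₀Wd : ∀ c, ℓ₀W (dSection X W c) = δ₀W c) (η : Γ(cotangentSheaf X, V)) :
    ℓ₀W ((cotangentSheaf X).presheaf.map (homOfLE hV).op η) = Y.left.presheaf.map (homOfLE hV').op (ℓ₀ η) := by
  -- both sides as additive `f♯`-semilinear maps out of `Γ(V, Ω¹_X)`
  let A : Γ(cotangentSheaf X, V) →+ Γ(Y.left, W') :=
    AddMonoidHom.mk' (fun η => ℓ₀W ((cotangentSheaf X).presheaf.map (homOfLE hV).op η)) fun a c => by
      simp only [map_add]
  let B : Γ(cotangentSheaf X, V) →+ Γ(Y.left, W') :=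
    AddMonoidHom.mk' (fun η => Y.left.presheaf.map (homOfLE hV').op (ℓ₀ η)) fun a c => by
      simp only [map_add]
  have hVW' : W' ≤ f.left ⁻¹ᵁ V := hV'.trans hVV'
  have hA : ∀ (r : Γ(X.left, V)) (η : Γ(cotangentSheaf X, V)), A (r • η) = f.left.appLE V W' hVW' r * A η := by
    intro r η
    change ℓ₀W ((cotangentSheaf X).presheaf.map (homOfLE hV).op (r • η)) =
      f.left.appLE V W' hVW' r * ℓ₀W ((cotangentSheaf X).presheaf.map (homOfLE hV).op η)
    rw [Scheme.Modules.map_smul, hℓ₀W, ← CommRingCat.comp_apply, Scheme.Hom.map_appLE]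
  have hB : ∀ (r : Γ(X.left, V)) (η : Γ(cotangentSheaf X, V)), B (r • η) = f.left.appLE V W' hVW' r * B η := by
    intro r η
    change Y.left.presheaf.map (homOfLE hV').op (ℓ₀ (r • η)) =
      f.left.appLE V W' hVW' r * Y.left.presheaf.map (homOfLE hV').op (ℓ₀ η)
    rw [hℓ₀, map_mul, ← CommRingCat.comp_apply, Scheme.Hom.appLE_map]
  have hAB : A = B := by
    refine semilinear_ext_dSection (f.left.appLE V W' hVW').hom hVaff hA hB fun c => ?_
    change ℓ₀W ((cotangentSheaf X).presheaf.map (homOfLE hV).op (dSection X V c)) =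
      Y.left.presheaf.map (homOfLE hV').op (ℓ₀ (dSection X V c))
    rw [map_dSection, hℓ₀Wd, hℓ₀d]
    -- `δ₀^W(c|) = δ₀(c)|`: compare the two defect equations through `Φ`
    have h1 := hδ₀W (X.left.presheaf.map (homOfLE hV).op c)
    rw [← hΦX, hρ, hTQ, hTP, hρ', hδ₀ c, map_add, hΦY] at h1
    have h2 := add_left_cancel h1
    refine tmul_symm_one_injective J e (idealTensorIncl_injective (k := k) J ?_)
    rw [idealTensorIncl_tmul, idealTensorIncl_tmul]
    exact h2.symm
  exact DFunLike.congr_fun hAB η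

end Restrict

end Literature.AlgebraicGeometry.Deformation

end
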